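import Summits.BirchSwinnertonDyer.BirchSwinnertonDyer.Theorems.AdditiveKolyvaginRoadLevelSystemsOfSelmerDichotomy
import Summits.BirchSwinnertonDyer.BirchSwinnertonDyer.Theorems.AdditiveKolyvaginRoadLevelKolyvaginSystemsAdditiveGammaLocusKPA
import HarnessLib

/-!
# Route `AdditiveKolyvaginRoad`, crux `LevelKolyvaginSystemsAdditive` (item stmt-BirchSwinnertonDyer-21396, KS′):
# KS′'s conclusion on the (γ)-AVATAR LOCUS of line `epsilon_matched_retyping` WITHOUT W. Zhang's bipartite datum —
# Kriz–Li 1.16 + the E-side dichotomies only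
# (cell `pub/bsd-wall`, lead prover `cruxlead-stmt-BirchSwinnertonDyer-21396` g2; `--supports stmt-BirchSwinnertonDyer-21396`,
# helper; corollary of `…LevelSystemsOfSelmerDichotomy` and w3's `…GammaLocusKPA`)

WHY. The line result of record for line `epsilon_matched_retyping` (lead g0, p616119
`levelKolyvaginSystemsAdditive_onGammaAvatarLocus`; g0-a0, p619074 `…_onGoodAvatarDatumLocus`) proves KS′'s conclusion on the
(γ)-avatar locus GRANTED seven named facts, among them W. Zhang 2014 §§3–4 ∕ §8.1 (`WZhang2014.exists_levelRaisedBipartiteSystem`,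
«in print only for p ∤ N» — the datum every planner line identified as the crux's open content). On that same locus w3's
`kolyvaginPrimitiveAdditive_conclusion_on_gammaLocus` (p610708) gives the conclusion of the TARGET KPA′ from Kriz–Li Thm. 1.16
alone. By the lead's structural theorem (`nonempty_levelKolyvaginSystemP_of_selmerDichotomy`: the carrier ⟸ KPA′-at-frame +
E-side dichotomies) the Zhang datum is therefore ELIMINABLE on the locus: this file records KS′'s conclusion there granted ONLY
Kriz–Li 1.16 and the two E-side binders (K), (A²) — no p-parity, no Cassels–Tate, no PUB ∕ DUAL, no W. Zhang.

WHAT. `nonempty_levelKolyvaginSystemP_on_gammaLocus_of_selmerDichotomy` — frame ∧ (γ)-avatar (w3's binders verbatim) ∧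
`hKL` ∧ [𝒮 with dictionary, finite, (K) = (Lower) ∕ (Raise), (A²)] ⟹ `Nonempty (LevelKolyvaginSystemP W K p Dt β ι c)`.

HONEST FRAMING: one theorem; 0 definitions, 0 named facts, 0 `sorry`; CONDITIONAL on Kriz–Li 1.16 (refereed, typed) and on the
E-side binders (K), (A²) (Selmer algebra modulo Poitou–Tate; (K)-(Lower) is `selmerDichotomy_lower_of_localPackage` from the
landed LOC package); closes nothing (a sub-locus). BSD is not proved by any of this.

References: [cite: KrizLi2019, Thm. 1.16, Rem. 1.17] [cite: WZhang2014, Thm. 4.3, Lemma 5.3, Prop. 5.4, Thm. 7.2, §8.1,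
Lemma 8.2, Lemma 8.4] [cite: MazurRubin2004, Lemma 4.1.7] [cite: GrossLMS1991, §3, §4 (4.4)].
-/

-- single-conjunct summit: `Summit.BirchSwinnertonDyer.BirchSwinnertonDyer.…` repeats the name by design
set_option linter.dupNamespace false

noncomputable section

open scoped Classical

namespace Summit.BirchSwinnertonDyer.BirchSwinnertonDyer.Theorems.AdditiveKoly

open WeierstrassCurve NumberField IsDedekindDomain Field
  Literature.NumberTheory.EllipticCurves Literature.NumberTheory.EllipticCurves.ModularForms
  Literature.NumberTheory.EllipticCurves.Rank1Residual Literature.NumberTheory.GaloisRepresentations Module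
  Summit.BirchSwinnertonDyer.Rank1Residual
  Summit.BirchSwinnertonDyer.Rank1Residual.X11b.Three.Koly

variable (W : WeierstrassCurve ℚ) [W.IsElliptic] [W.IsGloballyMinimal] [NeZero (W.conductorNorm ℤ)]
  (p : ℕ) [hp : Fact p.Prime] (K : Type) [Field K] [NumberField K]
  (Dt : ModularParametrizationData W (W.conductorNorm ℤ)) (β : ℤ) (ι : K →+* ℂ) (c : K ≃ₐ[ℚ] K)
  [Module (ZMod p) (Vp W K p)]

/-- **KS′'s conclusion on the (γ)-avatar locus from Kriz–Li 1.16 and the E-side dichotomies — no W. Zhang datum.** Frame: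
`E = W` globally minimal, additive at `p ≥ 5`, `ρ̄_{E,p}` onto, `K` imaginary quadratic with `d_K < −4`, Heegner hypothesis,
`4N ∣ β² − d_K`, `p ∤ c(Dt)`; (γ)-avatar `E₀ = W₀` (w3's binders verbatim: `Γ_ℚ`-equivariant `E[p] ≃ E₀[p]`, good non-anomalous at
`p`, `hrad`, `htype`, sign agreement, Heegner hypothesis for `N₀`, `p ∤ c(Dt₀)`, log certificate along `ιp`); `hKL` = Kriz–Li
Thm. 1.16 BY NAME; `𝒮` with the membership dictionary, finite, satisfying (K) and (A²). Proof:
`nonempty_levelKolyvaginSystemP_of_selmerDichotomy` fed with `kolyvaginPrimitiveAdditive_conclusion_on_gammaLocus`.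
[cite: KrizLi2019, Thm. 1.16] [cite: WZhang2014, Thm. 4.3, Thm. 7.2, §8.1] [cite: MazurRubin2004, Lemma 4.1.7] -/
theorem nonempty_levelKolyvaginSystemP_on_gammaLocus_of_selmerDichotomy
    (hKL : KrizLi2019.thm116_padicLogHeegner_congruence)
    (hp5 : 5 ≤ p) (hadd : Addv W p) (hs : W.HasSurjectiveModNGaloisRep p)
    (hK : IsImaginaryQuadratic K) (hlt : NumberField.discr K < -4)
    (hH : SatisfiesHeegnerHypothesis (W.conductorNorm ℤ) K)
    (hβ : (4 * (W.conductorNorm ℤ : ℤ)) ∣ β ^ 2 - NumberField.discr K) (hc : ¬ (p : ℤ) ∣ Dt.c)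
    (W₀ : WeierstrassCurve ℚ) [W₀.IsElliptic] [W₀.IsGloballyMinimal] [NeZero (W₀.conductorNorm ℤ)]
    (e : geomTorsion W (p : ℤ) ≃+ geomTorsion W₀ (p : ℤ))
    (he : ∀ (σ : absoluteGaloisGroup ℚ) (T : geomTorsion W (p : ℤ)), e (σ • T) = σ • e T)
    (hgood₀ : W₀.HasGoodReductionAtPrime p) (hna : ¬ (p : ℤ) ∣ W₀.frobeniusTrace p - 1)
    (hrad : ∀ q : ℕ, q.Prime → (q ∣ p * W.conductorNorm ℤ ↔ q ∣ p * W₀.conductorNorm ℤ))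
    (htype : ∀ (ℓ : ℕ) [Fact ℓ.Prime], W.HasMultiplicativeReductionAtPrime ℓ ↔ W₀.HasMultiplicativeReductionAtPrime ℓ)
    (hsign : ∀ (ℓ : ℕ) [Fact ℓ.Prime], W₀.HasMultiplicativeReductionAtPrime ℓ → W.LFunction ℓ = W₀.LFunction ℓ)
    (Dt₀ : ModularParametrizationData W₀ (W₀.conductorNorm ℤ)) (hc₀ : ¬ (p : ℤ) ∣ Dt₀.c)
    (hH₀ : SatisfiesHeegnerHypothesis (W₀.conductorNorm ℤ) K) (ιp : K →+* ℚ_[p])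
    (hcert : ∃ (H₀ : HeegnerDatum (W₀.conductorNorm ℤ) (NumberField.discr K)) (y₀ : (W₀.baseChange K).toAffine.Point),
      WeierstrassCurve.Affine.Point.map ι.toRatAlgHom y₀ = heegnerPointComplex Dt₀ H₀ ∧
        ¬ ∃ Q : (W₀.baseChange ℚ_[p]).toAffine.Point, (p : ℤ) • Q = X11b.padicPointOf W₀ p ιp y₀)
    (𝒮 : Finset (AdmQ W K p) → Finset {ℓ // Zhang2014.IsKolyvaginPrime (W.conductorNorm ℤ) W K p ℓ} → Bool →
      Submodule (ZMod p) (Vp W K p))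
    (h𝒮 : ∀ (n : Finset (AdmQ W K p)) (m : Finset {ℓ // Zhang2014.IsKolyvaginPrime (W.conductorNorm ℤ) W K p ℓ})
      (μ : Bool) (x : Vp W K p), x ∈ 𝒮 n m μ ↔
        conjAct W c ((p ^ 1 : ℕ) : ℤ) x = sgnP μ • x ∧
        (∀ w : InfinitePlace K, x ∈ selmerLocalKer (W.baseChange K) w.Completion ((p ^ 1 : ℕ) : ℤ)) ∧
        (∀ v : HeightOneSpectrum (𝓞 K), (∀ ℓ ∈ m, ((ℓ : ℕ) : 𝓞 K) ∉ v.asIdeal) → (∀ q ∈ n, ((q : ℕ) : 𝓞 K) ∉ v.asIdeal) →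
          x ∈ selmerLocalKer (W.baseChange K) (v.adicCompletion K) ((p ^ 1 : ℕ) : ℤ)) ∧
        (∀ q ∈ n, ∀ v : HeightOneSpectrum (𝓞 K), ((q : ℕ) : 𝓞 K) ∈ v.asIdeal →
          x ∈ toricLocalKer (W.baseChange K) (v.adicCompletion K) ((p ^ 1 : ℕ) : ℤ)) ∧
        (∀ ℓ ∈ m, ∀ v : HeightOneSpectrum (𝓞 K), ((ℓ : ℕ) : 𝓞 K) ∈ v.asIdeal → x ∈ transverseLocalKerP W K p ι ℓ v))
    (hfin : ∀ n m μ, Module.Finite (ZMod p) (𝒮 n m μ))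
    (hLower : ∀ (n : Finset (AdmQ W K p)), n.Nonempty → Even n.card →
      ∀ (m : Finset {ℓ // Zhang2014.IsKolyvaginPrime (W.conductorNorm ℤ) W K p ℓ})
        (ℓ : {ℓ // Zhang2014.IsKolyvaginPrime (W.conductorNorm ℤ) W K p ℓ}) (μ : Bool) (v : HeightOneSpectrum (𝓞 K)),
        ℓ ∉ m → ((ℓ : ℕ) : 𝓞 K) ∈ v.asIdeal →
        (∃ x ∈ 𝒮 n m μ, x ∉ (W.baseChange K).torsionLocalKer (v.adicCompletion K) ((p ^ 1 : ℕ) : ℤ)) →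
        (∀ y ∈ 𝒮 n (insert ℓ m) μ, y ∈ (W.baseChange K).torsionLocalKer (v.adicCompletion K) ((p ^ 1 : ℕ) : ℤ)) ∧
          finrank (ZMod p) (𝒮 n (insert ℓ m) μ) + 1 = finrank (ZMod p) (𝒮 n m μ))
    (hRaise : ∀ (n : Finset (AdmQ W K p)), n.Nonempty → Even n.card →
      ∀ (m : Finset {ℓ // Zhang2014.IsKolyvaginPrime (W.conductorNorm ℤ) W K p ℓ})
        (ℓ : {ℓ // Zhang2014.IsKolyvaginPrime (W.conductorNorm ℤ) W K p ℓ}) (μ : Bool) (v : HeightOneSpectrum (𝓞 K)),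
        ℓ ∉ m → ((ℓ : ℕ) : 𝓞 K) ∈ v.asIdeal →
        (∀ x ∈ 𝒮 n m μ, x ∈ (W.baseChange K).torsionLocalKer (v.adicCompletion K) ((p ^ 1 : ℕ) : ℤ)) →
        finrank (ZMod p) (𝒮 n (insert ℓ m) μ) = finrank (ZMod p) (𝒮 n m μ) + 1)
    (hTwoStep : ∀ (n : Finset (AdmQ W K p)) (q₁ q₂ : AdmQ W K p), n.Nonempty → Even n.card → q₁ ∉ n → q₂ ∉ insert q₁ n →
      ∀ (m : Finset {ℓ // Zhang2014.IsKolyvaginPrime (W.conductorNorm ℤ) W K p ℓ}) (μ : Bool),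
        finrank (ZMod p) (𝒮 (insert q₂ (insert q₁ n)) m true) + finrank (ZMod p) (𝒮 (insert q₂ (insert q₁ n)) m false) = 1 →
        (∃ g ∈ 𝒮 (insert q₂ (insert q₁ n)) m μ, ∃ v : HeightOneSpectrum (𝓞 K), ((q₂ : ℕ) : 𝓞 K) ∈ v.asIdeal ∧
          g ∉ (W.baseChange K).torsionLocalKer (v.adicCompletion K) ((p ^ 1 : ℕ) : ℤ)) →
        finrank (ZMod p) (𝒮 n m true) + finrank (ZMod p) (𝒮 n m false) = 1) :
    Nonempty (LevelKolyvaginSystemP W K p Dt β ι c) :=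
  nonempty_levelKolyvaginSystemP_of_selmerDichotomy W K p Dt β ι c hK hH hβ 𝒮 h𝒮 hfin hLower hRaise hTwoStep
    (kolyvaginPrimitiveAdditive_conclusion_on_gammaLocus W p K Dt β ι hKL hp5 hadd hs hK hlt hH hβ hc W₀ e he hgood₀ hna
      hrad htype hsign Dt₀ hc₀ hH₀ ιp hcert)

end Summit.BirchSwinnertonDyer.BirchSwinnertonDyer.Theorems.AdditiveKoly

end
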